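import Mathlib
import HarnessLib
import HarnessLib.Audit
import Summits.Schanuel.Statement

/-!
Route: PellOrbitShapiro

CLOSED (retired) 2026-08-15T13:51:25Z by operator:999:1257524 — reason: not-a-thesis: assembly does not conclude the sub-problem Statement — note: D-0027 §2.1 audit (human 2026-08-15: routes that do not decide the summit are removed): the assembly concludes `TwoFrequencyFiniteness`, not the sub-problem statement; a NEW conforming route may be opened from the same idea (generated `closes : … → _root_.Schanuel`).. The file is kept as the record of this route; refuted decls are indexed as negative knowledge (`ledger negatives`).

# Route PellOrbitShapiro — Pell-orbit rigidity — second-order zero asymptotics + bounded norms prove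
two-frequency Shapiro finiteness for real-quadratic slopes; the atoms left are slopes of degree ≥ 3
and non-torsion phases

Rung route with an honest ceiling, realising card pell-orbit-analyticity-shapiro. X =
TwoFrequencyFiniteness: for β ∈ ℚ̄ ∖ ℚ and nonzero
P₁, Q₁, P₂, Q₂ ∈ ℚ̄[z], the binomial exponential polynomials f = P₁e^z − Q₁ and g = P₂e^{βz} − Q₂
have only FINITELY many common zeros —
Jossen's Conjecture 1.1(ii) / Shapiro's conjecture over ℚ̄ for the two-frequency family, a theorem
under Schanuel (FischlerRivoal2025
Thm 1.7; support TwoFrequencyOfSchanuel records X ⟸ Schanuel), unconditionally known only when P₁,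
Q₁ are constants (f simple:
VanDerPoortenTijdeman1975). X is exactly the linear-axis cell foreseen in route ModulusFirst's
two-layer plan (child of
UnitaryAxisFiniteness, stmt-Schanuel-4147) and a cell of route CoprimeExpPolynomials' crux
CoprimeExpPolynomialsFiniteCommonZeros
(stmt-Schanuel-3764); every common zero t ≠ 0 off the roots of P₁P₂ is a Schanuel(2) counterexample
(t, βt). The route decomposes X
by the ARITHMETIC OF THE SLOPE β: non-unitary data (support, Gel'fond–Schneider), β real quadratic
with torsion phases (Theorem P, the
new unconditional theorem), and the two atoms (β of degree ≥ 3; non-torsion phases) as the ranked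
open cruxes.
Lean: `∀ (β : ℂ) (P₁ Q₁ P₂ Q₂ : Polynomial ↥(algebraicClosure ℚ ℂ)), IsAlgebraic ℚ β → β ∉ Set.range
((↑) : ℚ → ℂ) → P₁ ≠ 0 → Q₁ ≠ 0 → P₂ ≠ 0 → Q₂ ≠ 0 → Set.Finite {z : ℂ | Polynomial.aeval z P₁ *
Complex.exp z = Polynomial.aeval z Q₁ ∧ Polynomial.aeval z P₂ * Complex.exp (β * z) =
Polynomial.aeval z Q₂}`

## Assembly
Pure logic (sorry-free `example` in the planner's Sketch.lean): fix β, Pᵢ, Qᵢ; if the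
unitary-balanced-real condition U fails, NonUnitaryFiniteness;
if U holds and both leading ratios are torsion, split on (minpoly ℚ β).natDegree ≤ 2
(QuadraticSlopeFiniteness) versus ≥ 3
(HigherDegreeSlopeFiniteness, `omega`); if U holds and the ratios are not both torsion,
NonTorsionPhaseFiniteness (U supplies β.im = 0,
the degree equalities and the two norm equalities). X is a rung: it is linked upward only by
TwoFrequencyOfSchanuel (Schanuel ⇒ X) and,
informally, as the linear-axis cell of ModulusFirst.UnitaryAxisFiniteness and of
CoprimeExpPolynomials.CoprimeExpPolynomialsFiniteCommonZeros;
it does not imply `Schanuel` and the route does not claim so.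

Rationale: WHY THIS LINE. Mechanism (card pell-orbit-analyticity-shapiro, refuter-checked 2026-08-15): every
zero of f with |z| large is z_k = iT_k − i a₁/T_k + O(T_k⁻²),
T_k = θ₁ + 2πk, where Q₁/P₁ = ω₁(1 + a₁/z + …) at infinity and ω₁ = e^{iθ₁}; Gel'fond–Schneider
(tree `gelfond_schneider_holds`) plus growth
comparison kills every regime except β real, deg Pᵢ = deg Qᵢ, |ωᵢ| = 1 (cf. the strip confinement of
Abbas–Hajj-Diab, zbl:1248.11057); there a
common zero forces the second-order resonance K(β̃K − M) = c/π² + O(1/K) on integers (K, M) (torsion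
phases, c ∈ ℚ̄ ∩ ℝ), and for β REAL
QUADRATIC the norm (β̃K − M)(β̃′K − M) is a bounded rational with bounded denominator, so K(β̃K − M)
is O(K⁻²)-close to the finite algebraic set
{N/(β̃′ − β̃)} — an identity c/π² = algebraic that Lindemann forbids (tree
`transcendental_pi_holds`), or N = 0, which irrationality forbids:
finiteness, effectively, with no Baker and no auxiliary function — an archimedean Skolem–Mahler–Lech
in which the unit group of ℤ[β] plays
the role of p (VanDerPoortenTijdeman1975 / DaquinoMacintyreTerzo2014 §3 use p-adic SML and need a
SIMPLE factor, which P₁e^z − Q₁ with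
deg P₁ ≥ 1 is not). Imported areas: zero distribution of exponential polynomials (Pólya–Ritt strip
theory, Ritt1929), Diophantine
approximation by quadratic irrationals (norm forms, Schmidt1980 Ch. I), transcendence only at PROVED
strength (Gelfond1934, Lindemann1882).
What prior routes do not do: ModulusFirst isolates the unitary axis geometrically and
CoprimeExpPolynomials grades by ℚ̄-rank, both naming
this card as the engine for the cell but filing nothing; this route files the cell, its provable
quadratic layer and its two atoms as typed
statements, so provers, refuters and the census card dirichlet-atom-census have items to attach to.
Montgomery's warning
(VanDerPoortenTijdeman1975 §5: "no classical approximation argument") is respected: approximation is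
claimed to win ONLY where near-resonances
are organised by a group (quadratic β), and the atoms say exactly where it cannot.

RANKED CRUXES. #0 TwoFrequencyFiniteness (target) — for β algebraic irrational and nonzero P₁, Q₁,
P₂, Q₂ ∈ ℚ̄[z], the set {z : P₁(z)e^z = Q₁(z) ∧ P₂(z)e^{βz} = Q₂(z)} is finite (two-frequency Jossen
(ii) / Shapiro over ℚ̄; card thesis X restricted to the linear-axis family). (why it might fail:
contains the atoms (cruxes 2, 3), e.g. (1−z)eᶻ−(1+z), (1−z)e^{∛2 z}−(1+z); known only under SC
(FischlerRivoal2025 Thm 1.7); one pair with infinitely many common zeros is ¬Schanuel.)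
[FischlerRivoal2025, Shapiro1958, VanDerPoortenTijdeman1975, DaquinoMacintyreTerzo2014,
zbl:1248.11057]
#2 HigherDegreeSlopeFiniteness (crux) — atom (α) of the card: β real algebraic with [ℚ(β):ℚ] ≥ 3,
deg P₁ = deg Q₁, deg P₂ = deg Q₂ and both leading ratios ωᵢ = lc(Qᵢ)/lc(Pᵢ) roots of unity ⇒ f, g
have finitely many common zeros. Equivalent (after the provable second-order reduction) to: K(β̃K −
M) → c/π² along no infinite family of integer pairs at rate O(1/K). [difficulty: open-problem] (why
it might fail: for [ℚ(β):ℚ] ≥ 3 near-resonances |β̃K − M| < C/K occur infinitely often (Dirichlet)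
with no unit structure; K(β̃K − M) has no known limit set (Roth is silent at exponent 2), so each
near-hit is an isolated SC(2) instance.) [Schmidt1980, FischlerRivoal2025,
DaquinoMacintyreTerzo2014, VanDerPoortenTijdeman1975]
#3 NonTorsionPhaseFiniteness (crux) — atom (β) of the card: β real algebraic irrational, deg Pᵢ =
deg Qᵢ, |ω₁| = |ω₂| = 1 but ω₁, ω₂ not both roots of unity ⇒ finitely many common zeros. The
resonance is inhomogeneous, |β̃K − M + ρ| < C/K with ρ = (β arg ω₁ − arg ω₂)/2π a Baker period, ρ ∉
ℚ(β) by Baker. [difficulty: open-problem] (why it might fail: needs |β log ω₁ − log ω₂ + 2πi(β̃K −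
M)·const| ≫ K^{-1-o(1)} uniformly — a linear form in three logarithms at exponent 1, beyond
Baker–Wüstholz; Minkowski gives infinitely many near-resonances < 1/(4K).) [BakerTNT1975,
Schmidt1980, FischlerRivoal2025, DaquinoMacintyreTerzo2014]
#4 QuadraticSlopeFiniteness (crux) — THEOREM P of the card (refuter-simplified form): β real
quadratic irrational, deg P₁ = deg Q₁, deg P₂ = deg Q₂, leading ratios ω₁, ω₂ roots of unity ⇒ f, g
have finitely many common zeros. Proof line: second-order zero asymptotics ⇒ K(β̃K − M) = c/π² +
O(1/K) with c ∈ ℚ̄ ∩ ℝ; bounded norm N = (β̃K − M)(β̃′K − M) ∈ (1/D)ℤ ⇒ K(β̃K − M) = N/(β̃′ − β̃) +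
O(K⁻²); π transcendental (tree transcendental_pi_holds) ⇒ c = 0 ⇒ N = 0 ⇒ K = 0. Settles
refuter-triage-3's example ((1−z)eᶻ−(1+z), (2−z)e^{√2z}−(2+z): c ∝ 2√2 − 4 ≠ 0). [difficulty: L]
(why it might fail: hinges on the second-order term βT_k − T′_l = (β Re a₁ − Re b₁)/T_k + O(T_k⁻²)
with complex a₁, b₁ and on the limit set {N/(β̃′−β̃)}; a slipped term could leave a resonant
subfamily with c = 0, N ≠ 0; Mathlib has no Rouché (zeros must be localised by hand).)
[VanDerPoortenTijdeman1975, DaquinoMacintyreTerzo2014, Lindemann1882, Schmidt1980,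
Literature.NumberTheory.Transcendental.transcendental_pi_holds]
#9 NonUnitaryFiniteness (support) — Step 0 of the card: if NOT (β real ∧ deg P₁ = deg Q₁ ∧ deg P₂ =
deg Q₂ ∧ |lc Q₁| = |lc P₁| ∧ |lc Q₂| = |lc P₂|) then f, g have finitely many common zeros — zeros of
f satisfy Re z = (deg Q₁ − deg P₁) log|z| + log|ω₁| + o(1), those of g the same with β; β ∉ ℝ makes
the chains point in different directions, a degree defect separates them logarithmically, and |ω₁|^β
= |ω₂| with |ω₁| ≠ 1 contradicts Gel'fond–Schneider (tree gelfond_schneider_holds; cf.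
Abbas–Hajj-Diab strip confinement). [difficulty: M] [Gelfond1934, zbl:1248.11057, zbl:1276.12001,
Ritt1929, Literature.NumberTheory.Transcendental.gelfond_schneider_holds]
#9 TwoFrequencyOfSchanuel (support) — calibration / honest ceiling: Schanuel ⇒
TwoFrequencyFiniteness — a common zero z with P₁(z) ≠ 0 has e^z, e^{βz} ∈ ℚ̄(z), so trdeg ℚ(z, βz,
e^z, e^{βz}) ≤ 1 while z, βz are ℚ-independent for z ≠ 0; hence common zeros ⊆ {0} ∪ roots(P₁),
finite (FischlerRivoal2025 Thm 1.7 pattern). [difficulty: provable-now] [FischlerRivoal2025,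
Lang1966]

TWO-LAYER PLAN. Foreseen glued splits (nothing filed now). HigherDegreeSlopeFiniteness ⇐
SecondOrderReduction (provable now, shared with crux 3 and with
QuadraticSlopeFiniteness as a `--supports` lemma: infinitely many common zeros ⇒ infinitely many
integer pairs with |K(β̃K − M) − c/π²| < C/K,
explicit β̃ = q₂β, c, C) → CubicScaleNonConvergence (pure Diophantine: for real algebraic β̃ of
degree ≥ 3 and real τ ∉ ℚ(β̃)… in fact
τ = c/π², only finitely many (K, M) with |β̃K² − KM − τ| < C/K) → HigherDegreeSlopeFiniteness.
NonTorsionPhaseFiniteness ⇐ the same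
reduction with inhomogeneous shift ρ → InhomogeneousScaleNonConvergence → NonTorsionPhaseFiniteness.
QuadraticSlopeFiniteness, if a
prover asks: ZeroChainAsymptotics (every zero of P e^z − Q with |z| ≥ R₀ is iT_k − i a/T_k +
O(T_k⁻²)) → BoundedNormRigidity (the
(1/D)ℤ-valued norm argument + π ∉ ℚ̄) → QuadraticSlopeFiniteness (k = 2). Later support, not a
layer: the general Theorem P for
f ∈ ℚ̄[z][e^z] of higher degree in e^z (several asymptotic roots, Puiseux-ramified chains) and the n
≥ 3 cone case via Schmidt's subspace
theorem once a `Literature` cite-fact for it exists (none in tree today; deliberately not imported).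

KILL CRITERIA. Every item is a consequence of Schanuel, so a genuine refutation of any of them (a
two-frequency pair over ℚ̄ with infinitely many common
zeros) is ¬Schanuel: close `refuted:<Decl>` and hand the witness to every Schanuel route.
Route-specific: (i) if a refuter breaks
QuadraticSlopeFiniteness AS DERIVED (second-order coefficient or norm bookkeeping wrong) but not as
a statement, restate via the card's
original identity-theorem form (analyticity in the unit parameter u = ε^{−j}) — pivot, not close;
(ii) if acq-02441 (Abbas–Hajj-Diab 2011)
or Diab 1975 already prove the unitary real-quadratic case, crux 4 is graded known and dropped to
support — the route survives on the atoms
only if they remain open there too, else close `superseded`; (iii)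
CoprimeExpPolynomialsFiniteCommonZeros (stmt-Schanuel-3764) or
ModulusFirst.UnitaryAxisFiniteness (stmt-Schanuel-4147) proved elsewhere moots X and closes the
route `superseded --by` that route.

NOT DECOMPOSED YET. The second-order reduction lemma and the zero-chain asymptotics (layer-2
children / `--supports` lemmas, above); the EFFECTIVE form of
Theorem P (explicit T₀(f, g) beyond which no common zero, from a certified separation of c/π² from
the finitely many N/(β̃′−β̃), plus a
certified count below T₀ — a kit task whose certificates attach as `computations` evidence, jointly
with card dirichlet-atom-census, to
cruxes 2–3 and to EclCore's NotSchanuel item stmt-Schanuel-0071); the general-degree Theorem P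
(several asymptotic roots ω_r, ramified
expansions in k^{−1/e}); the Schmidt-subspace finiteness for two ℚ-independent algebraic slopes (n ≥
3; needs a subspace-theorem cite-fact);
any glue into ModulusFirst's ExpVarieties language (the linear-axis curve {x₂ = βx₁, yᵢ = Rᵢ(x₁)} as
a W) — filed by that route's tenure
planner if wanted. No definition requests: ℚ̄ is `algebraicClosure ℚ ℂ`, torsion is `∃ n > 0, ωⁿ =
1`, "real quadratic" is
`(minpoly ℚ β).natDegree ≤ 2 ∧ β irrational ∧ β.im = 0`.

CHEAPEST FALSIFIER. (a) Re-derive the constant for the refuter's example independently: a₁ = 2, b₁ =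
4 (from (1+z)/(z−1) = 1 + 2/z + …, (2+z)/(z−2) = 1 + 4/z + …),
c ∝ β Re a₁ − Re b₁ = 2√2 − 4 ≠ 0 — done by hand this session, consistent with refuter-triage-16.
(b) kit (not run in this one-shot seat):
Newton-refine the two zero chains of that pair for |k| ≤ 10⁶ from the asymptotic seeds and confirm
min_k |K(√2·K̃ − M) − c/π²| stays
bounded below, as Theorem P predicts; an accumulation toward c/π² would expose a slipped term. (c)
Lookup when acq-02440/02441/02442 land
(Abbas–Hajj-Diab 2010/2011, Diab 1975): if the unitary quadratic case is in print, crux 4 is `known`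
(novelty demotion, not a kill).

NUMBERS. Shapiro 1958; simple-factor case 1975 (p-adic SML); SC ⇒ Jossen (ii) for exponential
polynomials over ℚ̄ 2025 (FischlerRivoal2025 Thm 1.7);
unconditional Jossen (ii): algebraic common root only (Beukers 2006, FischlerRivoal2025 p. 3).
Resonance scale: common zero at height
T ≍ 2πK forces |β̃K − M| ≤ C/K with C = q₁²q₂|β Re a₁ − Re b₁|/4π² + o(1); Minkowski's inhomogeneous
constant 1/4; for quadratic β̃ the
norm takes ≤ 2D·C·|β̃ − β̃′| + O(1) values. Refuter's example: ω₁ = ω₂ = −1 (θ = π, q = 2), a₁ = 2,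
b₁ = 4, β = √2. Items at open: 7
(1 target, 3 cruxes, 2 support, 1 assembly); named facts used as hypotheses: 0 (gelfond_schneider,
transcendental_pi, baker are PROVED in
tree); imports beyond the Statement: 0.

DEFINITION REQUESTS. None.

Novelty: Searches (2026-08-15): `lit frontier Schanuel --since 2020` (30 rows; none on zero sets of
exponential polynomials); `lit search --source zbmath
"common zeros exponential polynomials Shapiro conjecture"` (7: doi:10.4171/cmh/328, zbl:1248.11057,
zbl:1276.12001, zbl:0323.30003, …);
`lit search --source zbmath '"common zeros" exponential polynomials'` (25; zbl:0308.30006 =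
VanDerPoortenTijdeman1975 first, Laurent 1989 SML-type);
`lit galaxy search "common zeros of exponential polynomials" --star all` (3: Laczkovich Enseign.
Math. 50 (2004), CJM 67 (2015) SML-type, Borwein–
Shparlinski volume); `lit galaxy search "Shapiro's conjecture" --star pdf` (6;
D'Aquino–Fornasiero–Terzo TAMS 370 (2018), existence side);
`lit read arXiv:2503.20345` pp. 3–4 (Conj. 1.1, Thm 1.7, "only known results"), `lit read
arXiv:1206.6747` pp. 3, 5 (Montgomery's remark; Case 1
via SML); zbMATH API reviews of zbl:1248.11057 (strip confinement |Re μ₁z| < ε for algebraic data,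
frequencies in ℚμ₁ + ℚμ₂) and zbl:1276.12001
(further cases via Gel'fond–Schneider; full text requested acq-02441); `lean search`
(gelfond_schneider_holds, transcendental_pi_holds,
baker_holds proved; no subspace theorem); `ledger negatives --problem Schanuel` (0); the route files
ModulusFirst, CoprimeExpPolynomials and the
card's triage notes; OpenAlex HTTP 429 all session.
Nearest prior art found: VanDerPoortenTijdeman1975 (zbl:0308.30006) / DaquinoMacintyreTerzo2014 §3
(finiteness when one factor is SIMPLE, p-adic
SML); Abbas–Hajj-  [refs: 10.4171/cmh/328, 2503.20345, 1206.6747, doi:10.4171/cmh/328, VanDerPoortenTijdeman1975, DaquinoMacintyreTerzo2014, FischlerRivoal2025]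

Barriers (technique_class: zero-asymptotics unit-orbit-norms gelfond-schneider): - technique_class: zero-asymptotics unit-orbit-norms gelfond-schneider
- Literature.Barriers.Schanuel.AlgebraicIndependenceOfLogarithms: Gel'fond–Schneider is used once
(support NonUnitaryFiniteness) at its PROVED strength and Baker only to certify ρ ∉ ℚ(β) in the
wording of crux 3; no algebraic independence of logarithms is claimed; crux 3 is recorded precisely
as the place where a three-logarithm linear form at exponent 1 would be needed — delimited, not
evaded.
- Literature.Barriers.Schanuel.AxSchanuelFunctionalNotNumerical: consistent — the analytic input
(zero asymptotics, identity of limits) yields FINITENESS, never emptiness; the numerical input is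
explicit and proved (π ∉ ℚ̄, Gel'fond–Schneider, irrationality of β).
- Literature.Barriers.Schanuel.EFunctionValuesAtAlgebraicPoints: f, g are E-functions and
Siegel–Shidlovskii/Beukers give only the algebraic-common-root case (FischlerRivoal2025 p. 3); this
line never evaluates at algebraic points — it works on the ZERO SET at infinity, where the
Diophantine structure of the slope, not of the point, decides.
- Literature.Barriers.Schanuel.LargeTranscendenceDegree: other class — no auxiliary function, no
transcendence-degree lower bound beyond 1 is attempted; the route proves finiteness statements only.
- Literature.Barriers.Schanuel.LinearSubgroupMethodLimit: n/a — no matrices of logarithms / linear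
subgroup theorem.
- Literature.Barriers.Schanuel.NesterenkoModularScope,
Literature.Barriers.Schanuel.PeriodConjectureOverQba

History (route lifecycle, newest last):
- 2026-08-15T13:51:25Z · CLOSED retired — not-a-thesis: assembly does not conclude the sub-problem Statement (operator:999:1257524)

sub-problem: Schanuel · status: closed(retired) · opened planner-plancard-Schanuel-Schanuel-pell-orbit-52dd0543-0 2026-08-15T12:02:21Z · rev 0 · ledger route-Schanuel-PellOrbitShapiro
GENERATED by the gate from the ledger (D-0016/17). Provers cite these decls: `theorem foo : Summit.Schanuel.Schanuel.Theses.PellOrbitShapiro.<Decl> := …` in Summits/Schanuel/Schanuel/Theorems/<Name>.lean.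
-/

namespace Summit.Schanuel.Schanuel.Theses.PellOrbitShapiro

open scoped BigOperators Topology Manifold Classical MeasureTheory ProbabilityTheory Matrix InnerProductSpace ComplexConjugate ContinuousMap
open Filter Set Function TopologicalSpace MeasureTheory

attribute [summit_statement] _root_.Schanuel

open Literature.Periods

/-- item stmt-Schanuel-7103 · target · rank 0 · closed · moot by None · by planner
why it might fail: contains the atoms (cruxes 2, 3), e.g. (1−z)eᶻ−(1+z), (1−z)e^{∛2 z}−(1+z); known only under SC (FischlerRivoal2025 Thm 1.7); one pair with infinitely many common zeros is ¬Schanuel.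
sources: FischlerRivoal2025, Shapiro1958, VanDerPoortenTijdeman1975, DaquinoMacintyreTerzo2014, zbl:1248.11057
[target] for β algebraic irrational and nonzero P₁, Q₁, P₂, Q₂ ∈ ℚ̄[z], the set {z : P₁(z)e^z =
Q₁(z) ∧ P₂(z)e^{βz} = Q₂(z)} is finite (two-frequency Jossen (ii) / Shapiro over ℚ̄; card thesis X
restricted to the linear-axis family). -/
@[route_item "route-Schanuel-PellOrbitShapiro"]
def TwoFrequencyFiniteness : Prop :=
  ∀ (β : ℂ) (P₁ Q₁ P₂ Q₂ : Polynomial ↥(algebraicClosure ℚ ℂ)), IsAlgebraic ℚ β → β ∉ Set.range ((↑) : ℚ → ℂ) → P₁ ≠ 0 → Q₁ ≠ 0 → P₂ ≠ 0 → Q₂ ≠ 0 → Set.Finite {z : ℂ | Polynomial.aeval z P₁ * Complex.exp z = Polynomial.aeval z Q₁ ∧ Polynomial.aeval z P₂ * Complex.exp (β * z) = Polynomial.aeval z Q₂}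

/-- item stmt-Schanuel-7104 · crux · rank 2 · closed · moot by None · by planner
why it might fail: for [ℚ(β):ℚ] ≥ 3 near-resonances |β̃K − M| < C/K occur infinitely often (Dirichlet) with no unit structure; K(β̃K − M) has no known limit set (Roth is silent at exponent 2), so each near-hit is an isolated SC(2) instance.
sources: Schmidt1980, FischlerRivoal2025, DaquinoMacintyreTerzo2014, VanDerPoortenTijdeman1975
[crux] atom (α) of the card: β real algebraic with [ℚ(β):ℚ] ≥ 3, deg P₁ = deg Q₁, deg P₂ = deg Q₂
and both leading ratios ωᵢ = lc(Qᵢ)/lc(Pᵢ) roots of unity ⇒ f, g have finitely many common zeros.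
Equivalent (after the provable second-order reduction) to: K(β̃K − M) → c/π² along no infinite
family of integer pairs at rate O(1/K). [difficulty: open-problem] -/
@[route_item "route-Schanuel-PellOrbitShapiro"]
def HigherDegreeSlopeFiniteness : Prop :=
  ∀ (β : ℂ) (P₁ Q₁ P₂ Q₂ : Polynomial ↥(algebraicClosure ℚ ℂ)), IsAlgebraic ℚ β → β ∉ Set.range ((↑) : ℚ → ℂ) → 3 ≤ (minpoly ℚ β).natDegree → β.im = 0 → P₁ ≠ 0 → Q₁ ≠ 0 → P₂ ≠ 0 → Q₂ ≠ 0 → P₁.natDegree = Q₁.natDegree → P₂.natDegree = Q₂.natDegree → (∃ n : ℕ, 0 < n ∧ ((Q₁.leadingCoeff : ℂ) / (P₁.leadingCoeff : ℂ)) ^ n = 1 ∧ ((Q₂.leadingCoeff : ℂ) / (P₂.leadingCoeff : ℂ)) ^ n = 1) → Set.Finite {z : ℂ | Polynomial.aeval z P₁ * Complex.exp z = Polynomial.aeval z Q₁ ∧ Polynomial.aeval z P₂ * Complex.exp (β * z) = Polynomial.aeval z Q₂}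

/-- item stmt-Schanuel-7105 · crux · rank 3 · closed · moot by None · by planner
why it might fail: needs |β log ω₁ − log ω₂ + 2πi(β̃K − M)·const| ≫ K^{-1-o(1)} uniformly — a linear form in three logarithms at exponent 1, beyond Baker–Wüstholz; Minkowski gives infinitely many near-resonances < 1/(4K).
sources: BakerTNT1975, Schmidt1980, FischlerRivoal2025, DaquinoMacintyreTerzo2014
[crux] atom (β) of the card: β real algebraic irrational, deg Pᵢ = deg Qᵢ, |ω₁| = |ω₂| = 1 but ω₁,
ω₂ not both roots of unity ⇒ finitely many common zeros. The resonance is inhomogeneous, |β̃K − M +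
ρ| < C/K with ρ = (β arg ω₁ − arg ω₂)/2π a Baker period, ρ ∉ ℚ(β) by Baker. [difficulty:
open-problem] -/
@[route_item "route-Schanuel-PellOrbitShapiro"]
def NonTorsionPhaseFiniteness : Prop :=
  ∀ (β : ℂ) (P₁ Q₁ P₂ Q₂ : Polynomial ↥(algebraicClosure ℚ ℂ)), IsAlgebraic ℚ β → β ∉ Set.range ((↑) : ℚ → ℂ) → β.im = 0 → P₁ ≠ 0 → Q₁ ≠ 0 → P₂ ≠ 0 → Q₂ ≠ 0 → P₁.natDegree = Q₁.natDegree → P₂.natDegree = Q₂.natDegree → ‖(Q₁.leadingCoeff : ℂ)‖ = ‖(P₁.leadingCoeff : ℂ)‖ → ‖(Q₂.leadingCoeff : ℂ)‖ = ‖(P₂.leadingCoeff : ℂ)‖ → ¬ (∃ n : ℕ, 0 < n ∧ ((Q₁.leadingCoeff : ℂ) / (P₁.leadingCoeff : ℂ)) ^ n = 1 ∧ ((Q₂.leadingCoeff : ℂ) / (P₂.leadingCoeff : ℂ)) ^ n = 1) → Set.Finite {z : ℂ | Polynomial.aeval z P₁ * Complex.exp z = Polynomial.aeval z Q₁ ∧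 Polynomial.aeval z P₂ * Complex.exp (β * z) = Polynomial.aeval z Q₂}

/-- item stmt-Schanuel-7106 · crux · rank 4 · closed · moot by None · by planner
why it might fail: hinges on the second-order term βT_k − T′_l = (β Re a₁ − Re b₁)/T_k + O(T_k⁻²) with complex a₁, b₁ and on the limit set {N/(β̃′−β̃)}; a slipped term could leave a resonant subfamily with c = 0, N ≠ 0; Mathlib has no Rouché (zeros must be localised by hand).
sources: VanDerPoortenTijdeman1975, DaquinoMacintyreTerzo2014, Lindemann1882, Schmidt1980, Literature.NumberTheory.Transcendental.transcendental_pi_holds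
[crux] THEOREM P of the card (refuter-simplified form): β real quadratic irrational, deg P₁ = deg
Q₁, deg P₂ = deg Q₂, leading ratios ω₁, ω₂ roots of unity ⇒ f, g have finitely many common zeros.
Proof line: second-order zero asymptotics ⇒ K(β̃K − M) = c/π² + O(1/K) with c ∈ ℚ̄ ∩ ℝ; bounded norm
N = (β̃K − M)(β̃′K − M) ∈ (1/D)ℤ ⇒ K(β̃K − M) = N/(β̃′ − β̃) + O(K⁻²); π transcendental (tree
transcendental_pi_holds) ⇒ c = 0 ⇒ N = 0 ⇒ K = 0. Settles refuter-triage-3's example ((1−z)eᶻ−(1+z),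
(2−z)e^{√2z}−(2+z): c ∝ 2√2 − 4 ≠ 0). [difficulty: L] -/
@[route_item "route-Schanuel-PellOrbitShapiro"]
def QuadraticSlopeFiniteness : Prop :=
  ∀ (β : ℂ) (P₁ Q₁ P₂ Q₂ : Polynomial ↥(algebraicClosure ℚ ℂ)), IsAlgebraic ℚ β → β ∉ Set.range ((↑) : ℚ → ℂ) → (minpoly ℚ β).natDegree ≤ 2 → β.im = 0 → P₁ ≠ 0 → Q₁ ≠ 0 → P₂ ≠ 0 → Q₂ ≠ 0 → P₁.natDegree = Q₁.natDegree → P₂.natDegree = Q₂.natDegree → (∃ n : ℕ, 0 < n ∧ ((Q₁.leadingCoeff : ℂ) / (P₁.leadingCoeff : ℂ)) ^ n = 1 ∧ ((Q₂.leadingCoeff : ℂ) / (P₂.leadingCoeff : ℂ)) ^ n = 1) → Set.Finite {z : ℂ | Polynomial.aeval z P₁ * Complex.exp z = Polynomial.aeval z Q₁ ∧ Polynomial.aeval z P₂ * Complex.exp (β * z) = Polynomial.aeval z Q₂}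

/-- item stmt-Schanuel-7107 · support · rank 9 · closed · moot by None · by planner
sources: Gelfond1934, zbl:1248.11057, zbl:1276.12001, Ritt1929, Literature.NumberTheory.Transcendental.gelfond_schneider_holds
[support] Step 0 of the card: if NOT (β real ∧ deg P₁ = deg Q₁ ∧ deg P₂ = deg Q₂ ∧ |lc Q₁| = |lc P₁|
∧ |lc Q₂| = |lc P₂|) then f, g have finitely many common zeros — zeros of f satisfy Re z = (deg Q₁ −
deg P₁) log|z| + log|ω₁| + o(1), those of g the same with β; β ∉ ℝ makes the chains point in
different directions, a degree defect separates them logarithmically, and |ω₁|^β = |ω₂| with |ω₁| ≠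
1 contradicts Gel'fond–Schneider (tree gelfond_schneider_holds; cf. Abbas–Hajj-Diab strip
confinement). [difficulty: M] -/
@[route_item "route-Schanuel-PellOrbitShapiro"]
def NonUnitaryFiniteness : Prop :=
  ∀ (β : ℂ) (P₁ Q₁ P₂ Q₂ : Polynomial ↥(algebraicClosure ℚ ℂ)), IsAlgebraic ℚ β → β ∉ Set.range ((↑) : ℚ → ℂ) → P₁ ≠ 0 → Q₁ ≠ 0 → P₂ ≠ 0 → Q₂ ≠ 0 → ¬ (β.im = 0 ∧ P₁.natDegree = Q₁.natDegree ∧ P₂.natDegree = Q₂.natDegree ∧ ‖(Q₁.leadingCoeff : ℂ)‖ = ‖(P₁.leadingCoeff : ℂ)‖ ∧ ‖(Q₂.leadingCoeff : ℂ)‖ = ‖(P₂.leadingCoeff : ℂ)‖) → Set.Finite {z : ℂ | Polynomial.aeval z P₁ * Complex.exp z = Polynomial.aeval z Q₁ ∧ Polynomial.aeval z P₂ * Complex.exp (β * z) = Polynomial.aeval z Q₂}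

/-- item stmt-Schanuel-7108 · support · rank 9 · closed · moot by None · by planner
sources: FischlerRivoal2025, Lang1966
[support] calibration / honest ceiling: Schanuel ⇒ TwoFrequencyFiniteness — a common zero z with
P₁(z) ≠ 0 has e^z, e^{βz} ∈ ℚ̄(z), so trdeg ℚ(z, βz, e^z, e^{βz}) ≤ 1 while z, βz are ℚ-independent
for z ≠ 0; hence common zeros ⊆ {0} ∪ roots(P₁), finite (FischlerRivoal2025 Thm 1.7 pattern).
[difficulty: provable-now] -/
@[route_item "route-Schanuel-PellOrbitShapiro"]
def TwoFrequencyOfSchanuel : Prop :=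
  Schanuel → TwoFrequencyFiniteness

/-- item stmt-Schanuel-7109 · assembly · rank 1 · closed · moot by None · by planner
sources: FischlerRivoal2025, DaquinoMacintyreTerzo2014
[assembly] NonUnitaryFiniteness → QuadraticSlopeFiniteness → HigherDegreeSlopeFiniteness →
NonTorsionPhaseFiniteness → TwoFrequencyFiniteness (regime decomposition by the arithmetic of β and
of the leading ratios; HONEST CEILING: X is a rung below Schanuel). -/
@[route_item "route-Schanuel-PellOrbitShapiro"]
def Assembly : Prop :=
  NonUnitaryFiniteness → QuadraticSlopeFiniteness → HigherDegreeSlopeFiniteness → NonTorsionPhaseFiniteness → TwoFrequencyFiniteness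

end Summit.Schanuel.Schanuel.Theses.PellOrbitShapiro
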